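import Summits.Parity.GeneralizedHardyLittlewood.Theses.LeeYangFibres
import Summits.Parity.GeneralizedHardyLittlewood.Theorems.LeeYangFibresCellParityLawSavingVariantDefs
import Summits.Parity.GeneralizedHardyLittlewood.Theorems.LeeYangFibresCellParityLawSavingReduction
import Summits.Parity.GeneralizedHardyLittlewood.Theorems.LeeYangFibresCellParityLawSavingHypGS
import Summits.Parity.GeneralizedHardyLittlewood.Theorems.LeeYangFibresCellParityLawSavingReduceGS
import Summits.Parity.GeneralizedHardyLittlewood.Theorems.LeeYangFibresCellParityLawSavingMainTermAlong
import Summits.Parity.GeneralizedHardyLittlewood.Theorems.LeeYangFibresCellParityLawSavingPrepAlong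
import Summits.Parity.GeneralizedHardyLittlewood.Theorems.LeeYangFibresCellParityLawSavingAssemblyAlong
import Summits.Parity.GeneralizedHardyLittlewood.Theorems.LeeYangFibresCellParityLawSeqBFacts
import Summits.Parity.GeneralizedHardyLittlewood.Theorems.LeeYangFibresCellParityLawSeqBCells
import Summits.Parity.GeneralizedHardyLittlewood.Theorems.LeeYangFibresCellParityLawDimension
import Summits.Parity.GeneralizedHardyLittlewood.Theorems.LeeYangFibresCellParityLawDimensionLow
import Summits.Parity.GeneralizedHardyLittlewood.Theorems.LeeYangFibresCellParityLawMertensLowerHead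
import HarnessLib

/-!
# Route `LeeYangFibres`, crux `CellParityLawSaving` (stmt-Parity-18104), line `superpoly-band-same-atom`:
# VARIANT B — the engine (sorry-free) and the CONDITIONAL closure from the polynomial kernel and the GS-adjacent atom

Companion of `LeeYangFibresCellParityLawSavingConditional` (Variant A: super-polynomial kernel `SuperPolyRoughCellLaw a`
+ EH-class atom `SectionLevelAlong`). Here VARIANT B (vocabulary `LeeYangFibresCellParityLawSavingVariantDefs`):

**Theorem 1 (`engineGS_holds`, sorry-free).** The POLYNOMIAL-rate kernel uniform in the roughness
(`PolyRoughCellLawUniform`, rate `u^{Cu} η^κ`) and the Granville–Soundararajan-adjacent atom for SOME exponent `c ≥ 2`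
(`SectionLevelGSAt c t`, level `N^{1-(log N)^{-1/c}}`) give, for every `t ≥ 1`, `LawSavAt t → SectionLawSavAt t` — by
`engineGS_of_pieces` over the two landed Variant-B glue stubs `stub_hypGS` (p165303: kernel hypotheses at deficit
`η = 2(log N)^{-1/c}`) and `stub_reduceGS` (p165449: the kernel applied, saving `min(κ/(2c),1)/4`, using
`U^{CU} = (log N)^{o(1)}`), the three KERNEL-AGNOSTIC landed engine pieces `stub_mainTermAlong` (p163446), `stub_prepAlong`
(p163067), `stub_assemblyAlong` (p163257), the sister crux's landed `u`-free inputs and `stub_densityAlong` (p159270).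

**Theorem 2 (`scheduleTransferGS`, sorry-free; CONDITIONAL closure).**
`PolyRoughCellLawUniform → (∃ c ≥ 2, ∀ t ≥ 1, SectionLevelGSAt c t) → LeeYangFibres.CellParityLawSaving`, by `composeSav2`
(landed base p161685, Walsh step p159624) and `cellParityLawSaving_of_lawSavAt`.

So the crux is kernel-checked conditionally on EITHER trust base:
  (A) `SuperPolyRoughCellLaw a` (some `a > 0`) ∧ `∀ t ≥ 1, SectionLevelAlong t`          (`scheduleTransfer`, Variant A)
  (B) `PolyRoughCellLawUniform` ∧ `∃ c ≥ 2, ∀ t ≥ 1, SectionLevelGSAt c t`                 (`scheduleTransferGS`, this file)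
— the exponent trade-off of the crux made explicit: a stronger kernel bet buys the EH-class atom, the plausible
(Friedlander–Iwaniec-type) polynomial kernel needs the stronger, GS-adjacent atom. Both kernels are research statements and
both atoms conjectures; nothing here is unconditional except the implications.

References: as in `LeeYangFibresCellParityLawSavingVariantDefs` [BombieriAsymptoticSieve1976, BombieriRIMS1977,
FriedlanderIwaniecPisa1978, Ford2004, GreenTao2010, Alladi1982, GranvilleSoundararajan2007].
-/

noncomputable section

open scoped BigOperators Classical
open Finset Literature.NumberTheory.Sieve
open Summit.Parity.GeneralizedHardyLittlewood.Cruxes.CellParityLaw.SectionAnnihilator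

namespace Summit.Parity.GeneralizedHardyLittlewood.Cruxes.CellParityLawSaving.SuperPolyBand

/-- **`engineGS_holds`** (registered; sorry-free): the Variant-B engine along the schedule — the two landed Variant-B
glue stubs composed with the kernel-agnostic landed pieces and the sister's `u`-free inputs by `engineGS_of_pieces`. -/
theorem engineGS_holds : EngineGS :=
  engineGS_of_pieces stub_sectionSeqBFacts stub_sectionSeqBCells stub_sectionDimension stub_sectionDimensionLow
    stub_sectionMertensLowerHead stub_singularRatio stub_densityAlong stub_hypGS stub_reduceGS
    stub_mainTermAlong stub_prepAlong stub_assemblyAlong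

/-- The law along the schedule for every number of forms, from the polynomial kernel and the GS atom. -/
theorem lawSavAt_of_polyKernel_of_atomGS (hKernel : PolyRoughCellLawUniform)
    (hAtom : ∃ c : ℕ, 2 ≤ c ∧ ∀ t : ℕ, 1 ≤ t → SectionLevelGSAt c t) : ∀ t : ℕ, 1 ≤ t → LawSavAt t :=
  composeSav2 stub_densityAlong stub_singularRatio stub_walshStepSav lawSavAt_one (engineGS_holds hKernel hAtom)

/-- **`scheduleTransferGS`** (registered; sorry-free — Variant-B CONDITIONAL closure): polynomial kernel → GS atom → crux. -/
theorem scheduleTransferGS : PolyRoughCellLawUniform → (∃ c : ℕ, 2 ≤ c ∧ ∀ t : ℕ, 1 ≤ t → SectionLevelGSAt c t) → Summit.Parity.GeneralizedHardyLittlewood.Theses.LeeYangFibres.CellParityLawSaving :=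
  fun hKernel hAtom => cellParityLawSaving_of_lawSavAt (lawSavAt_of_polyKernel_of_atomGS hKernel hAtom)

/-- The same closure in the shape consumers cite. -/
theorem cellParityLawSaving_of_polyKernel_of_atomGS (hKernel : PolyRoughCellLawUniform)
    (hAtom : ∃ c : ℕ, 2 ≤ c ∧ ∀ t : ℕ, 1 ≤ t → SectionLevelGSAt c t) :
    Summit.Parity.GeneralizedHardyLittlewood.Theses.LeeYangFibres.CellParityLawSaving :=
  scheduleTransferGS hKernel hAtom

end Summit.Parity.GeneralizedHardyLittlewood.Cruxes.CellParityLawSaving.SuperPolyBand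

end
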